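import Literature.Analysis.FunctionSpaces.LittlewoodPaleyMultiplierProofs
import Literature.Analysis.FunctionSpaces.LittlewoodPaleyInhomogeneousProofs
import HarnessLib

/-!
# Second derivatives of the low-frequency part: `‖∂_a ∂_b Ṡ₀ u‖_{L^p} ≤ C ‖u‖_{L^p}` (Schauder program, item A′2)

Topic `Literature/Analysis/FunctionSpaces`. The low-frequency cut-off `Ṡ₀ = χ(D)`
(`lowFreqCutoff 0`, symbol `lowFreqSymbol 0`, smooth with compact support) absorbs any number of
derivatives: `∂_a ∂_b Ṡ₀ = (2πi)² Θ_{ab}(D)` with the Schwartz symbol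
`Θ_{ab}(ξ) = χ(ξ) ⟨ξ, b⟩ ⟨ξ, a⟩`, hence is bounded on every `L^p`, `1 ≤ p ≤ ∞`, by
`(2π)² max(‖𝓕⁻¹Θ_{ab}‖_{L¹}, 1)` (`eLpNormDistrib_fourierMultiplierCLM_le`). This is the
low-frequency ("`‖u‖_∞`") term of the constant-coefficient Schauder estimate
`[D²u]_α ≤ C([Δu]_α + ‖u‖_∞)` (Gilbarg–Trudinger 2001, Thm. 4.8; Bahouri–Chemin–Danchin 2011,
Lemma 2.1).

* `lineDeriv_lineDeriv_lowFreqCutoff_eq` — the symbol identity;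
* `exists_eLpNormDistrib_lineDeriv_lineDeriv_lowFreqCutoff_le` — the bound.

Census item (2a) of `Literature.Geometry.Riemannian.gurskyViaclovsky_pathOpen_weighted_four`.
Everything is proved; no named facts.

## References

* H. Bahouri, J.-Y. Chemin, R. Danchin, *Fourier Analysis and Nonlinear PDE* (2011), Lemma 2.1.
  [BahouriCheminDanchin2011]
* D. Gilbarg, N. S. Trudinger, *Elliptic Partial Differential Equations of Second Order* (2001),
  Thm. 4.8. [GilbargTrudinger2001]
-/

noncomputable section

open MeasureTheory TemperedDistribution SchwartzMap Filter Topology Function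
open scoped SchwartzMap ENNReal NNReal FourierTransform Real ContDiff
open scoped LineDeriv Laplacian

namespace Literature.Analysis.FunctionSpaces

variable {E : Type*} [NormedAddCommGroup E] [InnerProductSpace ℝ E] [FiniteDimensional ℝ E]
  [MeasurableSpace E] [BorelSpace E] {F : Type*} [NormedAddCommGroup F] [NormedSpace ℂ F]
  [CompleteSpace F]

omit [MeasurableSpace E] [BorelSpace E] in
/-- The symbol `Θ_{ab}(ξ) = χ_j(ξ) ⟨ξ, b⟩ ⟨ξ, a⟩` is smooth with compact support. [folklore] -/
theorem contDiff_hasCompactSupport_lowFreqSymbol_mul_inner (j : ℤ) (a b : E) :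
    ContDiff ℝ ∞ (fun ξ : E => lowFreqSymbol j ξ * ((inner ℝ ξ b : ℝ) : ℂ) * ((inner ℝ ξ a : ℝ) : ℂ)) ∧
      HasCompactSupport (fun ξ : E => lowFreqSymbol j ξ * ((inner ℝ ξ b : ℝ) : ℂ) * ((inner ℝ ξ a : ℝ) : ℂ)) := by
  refine ⟨?_, ?_⟩
  · have h1 : ContDiff ℝ ∞ fun ξ : E => ((inner ℝ ξ b : ℝ) : ℂ) :=
      Complex.ofRealCLM.contDiff.comp ((contDiff_id.inner ℝ contDiff_const))
    have h2 : ContDiff ℝ ∞ fun ξ : E => ((inner ℝ ξ a : ℝ) : ℂ) :=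
      Complex.ofRealCLM.contDiff.comp ((contDiff_id.inner ℝ contDiff_const))
    exact ((contDiff_lowFreqSymbol j).mul h1).mul h2
  · exact ((hasCompactSupport_lowFreqSymbol j).mul_right).mul_right

omit [CompleteSpace F] in
/-- **`∂_a ∂_b Ṡ_j = (2πi)² Θ_{ab}(D)`** with `Θ_{ab}(ξ) = χ_j(ξ) ⟨ξ, b⟩ ⟨ξ, a⟩`. [folklore] -/
theorem lineDeriv_lineDeriv_lowFreqCutoff_eq (j : ℤ) (a b : E) (u : 𝓢'(E, F)) :
    ∂_{a} (∂_{b} (lowFreqCutoff j u)) = ((2 * π * Complex.I) * (2 * π * Complex.I)) •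
      fourierMultiplierCLM F
        (fun ξ : E => lowFreqSymbol j ξ * ((inner ℝ ξ b : ℝ) : ℂ) * ((inner ℝ ξ a : ℝ) : ℂ)) u := by
  have hb : (fun x : E => ((inner ℝ x b : ℝ) : ℂ)).HasTemperateGrowth := by fun_prop
  have ha : (fun x : E => ((inner ℝ x a : ℝ) : ℂ)).HasTemperateGrowth := by fun_prop
  have hχ := hasTemperateGrowth_lowFreqSymbol (E := E) j
  have hχb : (lowFreqSymbol j * fun ξ : E => ((inner ℝ ξ b : ℝ) : ℂ)).HasTemperateGrowth :=
    hχ.mul hb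
  rw [lowFreqCutoff_apply,
    TemperedDistribution.lineDeriv_eq_fourierMultiplierCLM b (fourierMultiplierCLM F _ u),
    TemperedDistribution.lineDeriv_eq_fourierMultiplierCLM a, map_smul,
    TemperedDistribution.fourierMultiplierCLM_fourierMultiplierCLM_apply hχ hb,
    TemperedDistribution.fourierMultiplierCLM_fourierMultiplierCLM_apply hχb ha, smul_smul]
  rfl

/-- **Two derivatives of the low-frequency part cost nothing**: for `1 ≤ p ≤ ∞` and `a, b ∈ E`
there is `C < ∞` with `‖∂_a ∂_b Ṡ_j u‖_{L^p} ≤ C ‖u‖_{L^p}` for all `u ∈ 𝓢'(E, F)`.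
[cite: BahouriCheminDanchin2011, Lemma 2.1] -/
theorem exists_eLpNormDistrib_lineDeriv_lineDeriv_lowFreqCutoff_le (p : ℝ≥0∞) [Fact (1 ≤ p)]
    (j : ℤ) (a b : E) :
    ∃ C : ℝ≥0∞, C < ⊤ ∧ ∀ u : 𝓢'(E, F),
      eLpNormDistrib p (∂_{a} (∂_{b} (lowFreqCutoff j u))) ≤ C * eLpNormDistrib p u := by
  have hΘ := contDiff_hasCompactSupport_lowFreqSymbol_mul_inner (E := E) j a b
  set Θ : 𝓢(E, ℂ) := hΘ.2.toSchwartzMap hΘ.1 with hΘdef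
  have hΘcoe : ((Θ : 𝓢(E, ℂ)) : E → ℂ) =
      fun ξ : E => lowFreqSymbol j ξ * ((inner ℝ ξ b : ℝ) : ℂ) * ((inner ℝ ξ a : ℝ) : ℂ) := rfl
  set c : ℂ := (2 * π * Complex.I) * (2 * π * Complex.I) with hc
  have hc0 : c ≠ 0 := by
    have h1 : (2 * π * Complex.I : ℂ) ≠ 0 := by
      refine mul_ne_zero (mul_ne_zero two_ne_zero ?_) Complex.I_ne_zero
      exact_mod_cast Real.pi_ne_zero
    exact mul_ne_zero h1 h1
  refine ⟨‖c‖ₑ * max (eLpNorm (⇑(𝓕⁻ Θ : 𝓢(E, ℂ))) 1 volume) 1, ?_, fun u => ?_⟩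
  · exact ENNReal.mul_lt_top enorm_lt_top
      (max_lt ((𝓕⁻ Θ).eLpNorm_lt_top 1 volume) ENNReal.one_lt_top)
  · rw [lineDeriv_lineDeriv_lowFreqCutoff_eq, ← hΘcoe, eLpNormDistrib_const_smul hc0, mul_assoc]
    gcongr
    exact eLpNormDistrib_fourierMultiplierCLM_le Θ u

end Literature.Analysis.FunctionSpaces

end
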